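import Summits.QuantumFields.BalabanUV.T4Continuum.Support.ShellMeasurePlaquetteCubicLocal
import Summits.QuantumFields.BalabanUV.T4Continuum.Support.ShellMeasureMultiGridNormsMax
import Summits.QuantumFields.BalabanUV.T4Continuum.Support.ShellMeasureWilsonGradientTailScaled

/-!
# `T4Continuum.ShellMeasureWilsonRemainderLevels` — row S65, junction J1: a ONE-GRID plaquette remainder with the
# (40)-SHAPE bound, `η`∕`Lʲη`-SCALED and FED INTO the live-level (98)-SHAPE theorems of row S65 f2a∕f2b∕f2c — generically,
# and for the `∇`-free remainder `V0remSym` of the ACTUAL symmetrised Wilson pair (row S65 f4)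

Cell `pub-balaban`, sub-cell `t4`, spine estimate NE7c (node U5b), NE7c ROUND-2 crew `t4-ne7c-formalise-*`, unit
`b2b-balaban-t4-ne7c-formalise-leaf-03` gen 5; owner table `t4/b2b-balaban-t4-ne7c-p1/LEAVES-NE7c-P1.md` v3.0 row **S65**
(holder `…-leaf-02` gen 8), junction **J1** (holder's GO journal l.16188; OFFER l.16562).  ADDITIVE: imports leaf-03-g4's
S65 f4 END `ShellMeasurePlaquetteCubicLocal` (p223811), leaf-02-g8's S65 f2c `ShellMeasureMultiGridNormsMax` (p222450;
hence f2a `ShellMeasureMultiGridNorms` p222079, f2b `ShellMeasureGradientTailLevels` p221515) and leaf-01-g5's S63 (a)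
`ShellMeasureWilsonGradientTailScaled` (p221130, the `η`-currency: `locGrad_smul_comp_smul`) ONLY; modifies nothing;
[folklore]; ONE data `def` (`etaScale`), 0 `def … : Prop`, 0 sorry, 0 citation tags.  An independent first
derivation of this bookkeeping (for a differently cut `V₀′`) is leaf-01-g6's staged `ShellMeasureWilsonCubicSplit{,Levels}`
(journal l.15887); nothing of it is copied here.

HONEST FRAMING.  Finite four-torus programme, rung (B)+1 only — NOT infinite volume, NOT a mass gap, NOT the Clay
problem, NOT summit progress; (B), `BetaPertHyp`, (B^μ) are not consumed.  NE7c (`T4IndicatorShell.ShellWeightBound`)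
is NOT PRINTED and NOT PROVED; «NE7c ⇐ the named binders» (WALL `t4/b2b-balaban-t4-ne7c-p1/WALL-NE7c-P1.md` §2).
Nothing of [Balaban1985Variational] (= cell paper B11) is asserted: (14), (32), (38)–(40), (97)–(98) are LOCATORS for
the SHAPE (the paper is under adjudication).  HONEST DEPENDENCY (cell, verbatim): continuum YM on T⁴ ⇐ BetaPertH ∧
nine spine estimates (0/9 proved); BetaPertH ⇐ (D1) ∧ (D4) ∧ CAP+tail; G-an2-4 gates asym, D1 and NE2/3/4.

THE POINT.  Row S65 f2a∕f2b∕f2c (`prop4Hyp_locGrad_levels`, `weighted_locGrad_le`, `prop4Hyp_locGrad_levels_max`) give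
the (97)∕(98) SHAPE at the live levels for ANY family of local plaquette functionals `φ_p` with three binders — (hloc)
locality, (ha) analyticity, (hcub) `‖φ_p A‖ ≤ (κ∕W p)·σ³` on the weighted polydisc.  The one-grid files (S65 f4
`ShellMeasurePlaquetteCubicLocal`: `V0remSym`; the holder's f5d `ShellMeasurePlaquetteCubicDictionary`: `V0remCov`) export
`∇`-free remainders `R` of the ACTUAL Wilson pair with locality, analyticity and a RAW one-grid bound of the shape
`‖R A‖ ≤ a·σ³ + c·σ⁴` (`‖A b‖ ≤ σ` on `∂p`, `4σ ≤ 1`), `a ∝ ‖U₀(∂p) − 1‖`.  This file is the bookkeeping in between: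
* §1 **`etaScale η R := A′ ↦ η⁻⁴·R(η • A′)`** (DATA) — the functional of the `η`-lattice field `A′` (`U₁ = exp(iηA′)`) in
  the currency in which functional derivatives are read through the pairing `⟨A′,B′⟩_η = ηᵈ Σ_b …` and the action
  carries `η^{d−4}`: **`locGrad_pairing_currency`** `η^{−d}•locGrad (η^{d−4}•R(η·)) = locGrad (η⁻⁴•R(η·))` for EVERY
  `d` (S63 (a) `locGrad_smul_comp_smul`), and `locGrad_etaScale`: `= η⁻³ • (locGrad R)(ηA′)`; the binders TRANSFER:
  `etaScale_add_single` (hloc), `analyticAt_etaScale` (ha), and **`hcub_etaScale`**: from the raw one-grid bound with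
  `a ≤ a₀·(η∕W p)²` — the PER-PLAQUETTE REGULARITY SHAPE of (38)'s «hidden additional factor η²» (print's input
  `|η⁻² Im U₀(∂p)| < C₁B₃ε₁(Lʲη)⁻²` from (2)∕(14), `W p = Lʲη`; a DISPLAYED BINDER, never proved here) —, `0 < η ≤ W p`
  and `4ε ≤ 1` to f2b's LITERAL `∀ A′ σ, 0 ≤ σ → σ < ε∕W p → (∀ b′ ∈ ∂p, ‖A′ b′‖ ≤ σ) → ‖etaScale η R A′‖ ≤ (κ∕W p)·σ³`
  with **`κ = a₀ + c·ε`** (arithmetic: `η⁻⁴(a(ησ)³ + c(ησ)⁴) = aη⁻¹σ³ + cσ⁴`, `aη⁻¹ ≤ a₀η∕(W p)² ≤ a₀∕W p`,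
  `σ⁴ ≤ (ε∕W p)σ³`, cap `4ησ ≤ 1` ⇐ `ησ ≤ ηε∕W p ≤ ε`) — the SHAPE of (40) «`|V₀′(A,∂p)| ≤ 64|A|³(C₁B₃ε₁ + ε₂)(Lʲη)⁻¹`»;
* §2 THE GENERIC ENDS — f2b∕f2a∕f2c FIRED on `φ_p := etaScale η (R p)` (weights `η ≤ W p ≤ w b ≤ Lc·W p` on `supp p`,
  `1 ≤ Lc`, incidence `≤ m`, `0 < ε`, `4ε ≤ 1`): **`weighted_locGrad_etaScale_le`** ((97) bond by bond, `8κ·m·Lc⁴·s²`),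
  **`prop4Hyp_locGrad_etaScale_levels`** (`Prop4Hyp (…) (8κ·m·Lc⁴) (ε∕2)` from `WSup w 1 𝔸` to `WSup w 3 (𝔸 →L[ℂ] ℂ)`),
  **`prop4Hyp_locGrad_etaScale_levels_max`** (the same from f2c's `WMax w w′ Dv`, ANY `∇`-datum — the summand the
  holder's f5d adds to the `∇`-part `ShellMeasureCommutatorLevels.prop4Hyp_locGrad_cubT_levels` by `Prop4Hyp.add`);
* §3 THE WILSON INSTANCE `R p := V0remSym τ U₀ (∂ p)` (S65 f4, trace-free, EVERY `τ`): with **`‖U₀(∂p) − 1‖ ≤ ε₀·(η∕W p)²`**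
  per plaquette the raw bound is f4's `norm_V0remSym_le_of_bonds` (`a p = ‖τ‖·32∕3·‖U₀(∂p) − 1‖`, `c = ‖τ‖·40∕3`), so
  **`κ = ‖τ‖·(32∕3·ε₀ + 40∕3·ε)`**: `hcub_V0remSym_eta`, **`weighted_locGrad_V0remSym_eta_le`**,
  **`prop4Hyp_locGrad_V0remSym_eta_levels(_max)`** —
  constants VOLUME-FREE (no `#Pl`, `#Λ`), k-UNIFORM (no number of scales).
INDEXING (holder's interface, journal l.16188): ABSTRACT finite bond type `Λ` and family `∂ : P → (Fin 4 → Λ × Bool)`,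
`supp p := bonds (∂ p)`; b08's geometry is the instance `Λ := ↥Λ₀`, `P := Fin d × Fin d × Site d`; §2 serves the holder's
`V0remCov` verbatim once its one-grid binders land (f5d file 2∕2).
NOT HERE: the `∇`-part (S65 f3∕f5, J2), the `Prop4Hyp.add` assembly (f5d), the HD-dressing (S66), the identification of
`Σ_p etaScale η (R p)` with Bałaban's sectioned `V₀′` and of the weights with `L^{j(b)}η` (node O ∕ [dict]).  No estimate
of Bałaban's is discharged.
-/

noncomputable section

open scoped BigOperators
open NormedSpace Metric Set

namespace Summit.QuantumFields.BalabanUV.T4Continuum.ShellMeasureWilsonRemainderLevels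

open Literature.MathematicalPhysics.QuantumFieldTheory.Balaban1983to89
open B11Prop6Scheme (Prop4Hyp)
open ShellMeasureWilsonGradientTail (plaqWord bonds)
open ShellMeasureLocalGradientTail (locGrad)
open ShellMeasurePlaquetteCubicLocal (V0remSym norm_V0remSym_le_of_bonds V0remSym_add_single analyticAt_V0remSym
  fst_mem_bonds)
open ShellMeasureGradientTailLevels (weighted_locGrad_le)
open ShellMeasureMultiGridNorms (WSup prop4Hyp_locGrad_levels)
open ShellMeasureMultiGridNormsMax (WMax prop4Hyp_locGrad_levels_max)
open ShellMeasureWilsonGradientTailScaled (locGrad_smul_comp_smul)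

variable {Λ : Type*} {𝔸 : Type*} [NormedRing 𝔸] [NormedAlgebra ℂ 𝔸]

/-! ## §1 The `η`-scaled functional and the transfer of the three binders -/

section Scale

/-- THE `η`-SCALED FUNCTIONAL `etaScale η R A′ := η⁻⁴ · R (η • A′)` — a one-grid functional `R` read on the `η`-lattice
field `A′` in the pairing currency of S63 (a) (DATA; `locGrad_pairing_currency` justifies the `η⁻⁴`). [folklore] -/
def etaScale (η : ℝ) (R : (Λ → 𝔸) → ℂ) (A : Λ → 𝔸) : ℂ := ((η : ℂ) ^ 4)⁻¹ * R ((η : ℂ) • A)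

/-- Scaling a single-bond perturbation: `c • Pi.single b X = Pi.single b (c • X)`. [folklore] -/
theorem smul_single [DecidableEq Λ] (c : ℂ) (b : Λ) (X : 𝔸) :
    c • (Pi.single b X : Λ → 𝔸) = Pi.single b (c • X) := by
  ext b'
  by_cases h : b' = b
  · subst h; simp
  · simp [h]

/-- **(hloc) TRANSFERS**: if `R` is blind to bonds off `S`, so is `etaScale η R`. [folklore] -/
theorem etaScale_add_single [DecidableEq Λ] {R : (Λ → 𝔸) → ℂ} {S : Finset Λ}
    (hloc : ∀ (A : Λ → 𝔸), ∀ b ∉ S, ∀ X : 𝔸, R (A + Pi.single b X) = R A) (η : ℝ) (A : Λ → 𝔸) {b : Λ}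
    (hb : b ∉ S) (X : 𝔸) : etaScale η R (A + Pi.single b X) = etaScale η R A := by
  rw [etaScale, etaScale, smul_add, smul_single, hloc _ b hb]

variable [Fintype Λ]

/-- **(ha) TRANSFERS**: if `R` is analytic everywhere, so is `etaScale η R`. [folklore] -/
theorem analyticAt_etaScale {R : (Λ → 𝔸) → ℂ} (ha : ∀ A, AnalyticAt ℂ R A) (η : ℝ) (A₀ : Λ → 𝔸) :
    AnalyticAt ℂ (etaScale η R) A₀ := by
  have hlin : AnalyticAt ℂ (fun A : Λ → 𝔸 => (η : ℂ) • A) A₀ := analyticAt_id.fun_const_smul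
  exact analyticAt_const.fun_mul ((ha ((η : ℂ) • A₀)).comp hlin)

/-- … hence `AnalyticOnNhd` on every set. [folklore] -/
theorem analyticOnNhd_etaScale {R : (Λ → 𝔸) → ℂ} (ha : ∀ A, AnalyticAt ℂ R A) (η : ℝ) (s : Set (Λ → 𝔸)) :
    AnalyticOnNhd ℂ (etaScale η R) s := fun A _ => analyticAt_etaScale ha η A

omit [Fintype Λ] in
/-- The weight arithmetic of (hcub) (pure reals). [folklore] -/
theorem hcub_arith {η Wp a a₀ c ε σ : ℝ} (hη : 0 < η) (hηW : η ≤ Wp) (ha₀ : 0 ≤ a₀) (hc : 0 ≤ c)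
    (haW : a ≤ a₀ * (η / Wp) ^ 2) (hσ0 : 0 ≤ σ) (hσ : σ ≤ ε / Wp) :
    (η ^ 4)⁻¹ * (a * (η * σ) ^ 3 + c * (η * σ) ^ 4) ≤ (a₀ + c * ε) / Wp * σ ^ 3 := by
  have hWp : 0 < Wp := hη.trans_le hηW
  have hq : η / Wp ≤ 1 := (div_le_one hWp).2 hηW
  have hq0 : 0 ≤ η / Wp := div_nonneg hη.le hWp.le
  have e : (η ^ 4)⁻¹ * (a * (η * σ) ^ 3 + c * (η * σ) ^ 4) = a / η * σ ^ 3 + c * σ * σ ^ 3 := by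
    field_simp
  rw [e]
  have h1 : a / η * σ ^ 3 ≤ a₀ / Wp * σ ^ 3 := by
    refine mul_le_mul_of_nonneg_right ?_ (pow_nonneg hσ0 3)
    rw [div_le_iff₀ hη]
    calc a ≤ a₀ * (η / Wp) ^ 2 := haW
      _ = a₀ * (η / Wp) * (η / Wp) := by ring
      _ ≤ a₀ * 1 * (η / Wp) := by gcongr
      _ = a₀ / Wp * η := by field_simp
  have h2 : c * σ * σ ^ 3 ≤ c * (ε / Wp) * σ ^ 3 := by
    refine mul_le_mul_of_nonneg_right ?_ (pow_nonneg hσ0 3)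
    exact mul_le_mul_of_nonneg_left hσ hc
  calc a / η * σ ^ 3 + c * σ * σ ^ 3 ≤ a₀ / Wp * σ ^ 3 + c * (ε / Wp) * σ ^ 3 := add_le_add h1 h2
    _ = (a₀ + c * ε) / Wp * σ ^ 3 := by
        field_simp

omit [Fintype Λ] in
/-- **(hcub) THE CUBIC BINDER IN ROW S65 f2b's LITERAL SHAPE, WEIGHT `W p`, FROM A RAW ONE-GRID BOUND.**  If
`‖R A‖ ≤ a·σ³ + c·σ⁴` whenever `‖A b‖ ≤ σ` on `S`, `0 ≤ σ`, `4σ ≤ 1`, and `a ≤ a₀·(η∕Wp)²` (the per-plaquette regularity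
SHAPE of (38)'s hidden `η²`), `0 ≤ a₀`, `0 ≤ c`, `0 < η ≤ Wp`, `4ε ≤ 1`, then
`∀ A′ σ, 0 ≤ σ → σ < ε∕Wp → (∀ b′ ∈ S, ‖A′ b′‖ ≤ σ) → ‖etaScale η R A′‖ ≤ ((a₀ + c·ε)∕Wp)·σ³` — the SHAPE of (40)
(nothing printed asserted). [folklore] -/
theorem hcub_etaScale {R : (Λ → 𝔸) → ℂ} {S : Finset Λ} {η Wp a a₀ c ε : ℝ} (hη : 0 < η) (hηW : η ≤ Wp)
    (ha₀ : 0 ≤ a₀) (hc : 0 ≤ c) (haW : a ≤ a₀ * (η / Wp) ^ 2) (hε4 : 4 * ε ≤ 1)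
    (hR : ∀ (A : Λ → 𝔸) (σ : ℝ), 0 ≤ σ → 4 * σ ≤ 1 → (∀ b ∈ S, ‖A b‖ ≤ σ) → ‖R A‖ ≤ a * σ ^ 3 + c * σ ^ 4) :
    ∀ (A : Λ → 𝔸) (σ : ℝ), 0 ≤ σ → σ < ε / Wp → (∀ b' ∈ S, ‖A b'‖ ≤ σ) →
      ‖etaScale η R A‖ ≤ (a₀ + c * ε) / Wp * σ ^ 3 := by
  intro A σ hσ0 hσ hA
  have hWp : 0 < Wp := hη.trans_le hηW
  -- the scaled field has local size `≤ ησ` on `S`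
  have hA' : ∀ b ∈ S, ‖((η : ℂ) • A) b‖ ≤ η * σ := by
    intro b hb
    rw [Pi.smul_apply, norm_smul, Complex.norm_real, Real.norm_of_nonneg hη.le]
    exact mul_le_mul_of_nonneg_left (hA b hb) hη.le
  -- the cap `4ησ ≤ 1`
  have hcap : 4 * (η * σ) ≤ 1 := by
    have hε : 0 ≤ ε := by
      have : 0 < ε / Wp := hσ0.trans_lt hσ
      exact ((div_pos_iff_of_pos_right hWp).1 this).le
    have h1 : η * σ ≤ η * (ε / Wp) := mul_le_mul_of_nonneg_left hσ.le hη.le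
    have h3 : (η / Wp) * ε ≤ 1 * ε := mul_le_mul_of_nonneg_right ((div_le_one hWp).2 hηW) hε
    have h2 : η * (ε / Wp) = (η / Wp) * ε := by ring
    nlinarith
  have h := hR _ _ (mul_nonneg hη.le hσ0) hcap hA'
  rw [etaScale, norm_mul, norm_inv, norm_pow, Complex.norm_real, Real.norm_of_nonneg hη.le]
  calc (η ^ 4)⁻¹ * ‖R ((η : ℂ) • A)‖ ≤ (η ^ 4)⁻¹ * (a * (η * σ) ^ 3 + c * (η * σ) ^ 4) :=
        mul_le_mul_of_nonneg_left h (inv_nonneg.2 (pow_nonneg hη.le 4))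
    _ ≤ (a₀ + c * ε) / Wp * σ ^ 3 := hcub_arith hη hηW ha₀ hc haW hσ0 hσ.le

variable [DecidableEq Λ]

/-- **THE PAIRING CURRENCY IS `η⁻⁴·R(η·)` FOR EVERY `d`.**  For `R` differentiable at `ηA′` and `η ≠ 0`: reading the
bond-local derivative of the `η`-lattice functional `η^{d−4}·R(η·)` through the pairing weight `ηᵈ` (S63 (a)) equals the
plain bond-local derivative of `η⁻⁴·R(η·)`. [folklore] -/
theorem locGrad_pairing_currency (R : (Λ → 𝔸) → ℂ) {η : ℝ} (hη : η ≠ 0) (d : ℕ) (A : Λ → 𝔸)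
    (hR : DifferentiableAt ℂ R ((η : ℂ) • A)) (b : Λ) :
    ((η : ℂ) ^ (d : ℤ))⁻¹ • locGrad (fun A => (η : ℂ) ^ ((d : ℤ) - 4) • R ((η : ℂ) • A)) A b =
      locGrad (etaScale η R) A b := by
  have hηC : (η : ℂ) ≠ 0 := Complex.ofReal_ne_zero.2 hη
  have e : etaScale η R = fun A => ((η : ℂ) ^ 4)⁻¹ • R ((η : ℂ) • A) := by
    funext A
    rw [etaScale, smul_eq_mul]
  rw [e, locGrad_smul_comp_smul R _ _ A hR b, locGrad_smul_comp_smul R _ _ A hR b, smul_smul]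
  congr 1
  rw [zpow_sub₀ hηC, zpow_natCast]
  field_simp

/-- **`locGrad (etaScale η R) A′ b = η⁻³ • (locGrad R) (η • A′) b`** (`η⁻⁴` from the currency, one `η` from the chain
rule), for `R` differentiable at `ηA′`, `η ≠ 0`. [folklore] -/
theorem locGrad_etaScale (R : (Λ → 𝔸) → ℂ) {η : ℝ} (hη : η ≠ 0) (A : Λ → 𝔸)
    (hR : DifferentiableAt ℂ R ((η : ℂ) • A)) (b : Λ) :
    locGrad (etaScale η R) A b = ((η : ℂ) ^ 3)⁻¹ • locGrad R ((η : ℂ) • A) b := by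
  have hηC : (η : ℂ) ≠ 0 := Complex.ofReal_ne_zero.2 hη
  have e : etaScale η R = fun A => ((η : ℂ) ^ 4)⁻¹ • R ((η : ℂ) • A) := by
    funext A
    rw [etaScale, smul_eq_mul]
  rw [e, locGrad_smul_comp_smul R _ _ A hR b]
  congr 1
  field_simp

omit [Fintype Λ] [DecidableEq Λ] in
/-- A finite sum of scaled functionals is the scaled sum. [folklore] -/
theorem sum_etaScale {P : Type*} (Pl : Finset P) (R : P → (Λ → 𝔸) → ℂ) (η : ℝ) :
    (fun A => ∑ p ∈ Pl, etaScale η (R p) A) = etaScale η (fun A => ∑ p ∈ Pl, R p A) := by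
  funext A
  simp only [etaScale, Finset.mul_sum]

end Scale

/-! ## §2 The generic ENDs: row S65 f2b∕f2a∕f2c FIRED on a scaled one-grid family -/

section Ends

variable [Fintype Λ] [DecidableEq Λ] {P : Type*} (Pl : Finset P) (R : P → (Λ → 𝔸) → ℂ) (supp : P → Finset Λ)
  (w : Λ → ℝ) (W : P → ℝ) (a : P → ℝ)

/-- **(97) BOND BY BOND FOR A SCALED ONE-GRID FAMILY** (row S65 f2b `weighted_locGrad_le` FIRED).  Data: one-grid
functionals `R p` LOCAL to `supp p`, analytic everywhere, with the raw bound `‖R p A‖ ≤ a p·σ³ + c·σ⁴` (`‖A b‖ ≤ σ` on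
`supp p`, `4σ ≤ 1`) and `a p ≤ a₀·(η∕W p)²`; positive bond weights `w`, plaquette weights `η ≤ W p ≤ w b ≤ Lc·W p` on
`supp p`, `1 ≤ Lc`, incidence `≤ m`, `4ε ≤ 1`.  Then for `w b·‖A′ b‖ ≤ s` (all `b`), `2s < ε`, and EVERY bond `b`:
`(w b)³·‖locGrad (Σ_{p∈Pl} etaScale η (R p)) A′ b‖ ≤ 8·(a₀ + c·ε)·m·Lc⁴·s²` — VOLUME-FREE, k-UNIFORM. [folklore] -/
theorem weighted_locGrad_etaScale_le {η ε a₀ c Lc : ℝ} {m : ℕ} (hη : 0 < η) (ha₀ : 0 ≤ a₀) (hc : 0 ≤ c)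
    (hε4 : 4 * ε ≤ 1) (hLc1 : 1 ≤ Lc) (hw : ∀ b, 0 < w b) (hηW : ∀ p ∈ Pl, η ≤ W p)
    (hWw : ∀ p ∈ Pl, ∀ b ∈ supp p, W p ≤ w b) (hwW : ∀ p ∈ Pl, ∀ b ∈ supp p, w b ≤ Lc * W p)
    (hloc : ∀ p ∈ Pl, ∀ A : Λ → 𝔸, ∀ b ∉ supp p, ∀ X : 𝔸, R p (A + Pi.single b X) = R p A)
    (ha : ∀ p ∈ Pl, ∀ A, AnalyticAt ℂ (R p) A)
    (hR : ∀ p ∈ Pl, ∀ (A : Λ → 𝔸) (σ : ℝ), 0 ≤ σ → 4 * σ ≤ 1 → (∀ b ∈ supp p, ‖A b‖ ≤ σ) →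
      ‖R p A‖ ≤ a p * σ ^ 3 + c * σ ^ 4)
    (haW : ∀ p ∈ Pl, a p ≤ a₀ * (η / W p) ^ 2)
    (hm : ∀ b : Λ, (Pl.filter (fun p => b ∈ supp p)).card ≤ m)
    {A : Λ → 𝔸} {s : ℝ} (hs : 0 ≤ s) (hA : ∀ b, w b * ‖A b‖ ≤ s) (h2s : 2 * s < ε) :
    ∀ b : Λ, w b ^ 3 * ‖locGrad (fun A => ∑ p ∈ Pl, etaScale η (R p) A) A b‖ ≤
      8 * (a₀ + c * ε) * m * Lc ^ 4 * s ^ 2 := by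
  have hε : 0 ≤ ε := by linarith
  have hκ : 0 ≤ a₀ + c * ε := by positivity
  have hW : ∀ p ∈ Pl, 0 < W p := fun p hp => hη.trans_le (hηW p hp)
  exact weighted_locGrad_le Pl (fun p => etaScale η (R p)) supp w W hκ hLc1 hw hW hWw hwW
    (fun p hp => (analyticOnNhd_etaScale (ha p hp) η _).differentiableOn)
    (fun p hp => hcub_etaScale hη (hηW p hp) ha₀ hc (haW p hp) hε4 (hR p hp))
    (fun p hp A b hb X => etaScale_add_single (hloc p hp) η A hb X) hm hs hA h2s

variable [hwf : Fact (∀ b, 0 < w b)]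

/-- **(98) FOR A SCALED ONE-GRID FAMILY AT THE LIVE LEVELS** (row S65 f2a `prop4Hyp_locGrad_levels` FIRED): under the
data of `weighted_locGrad_etaScale_le` (weights a `Fact` instance) and `0 < ε`, the bond-local gradient of
`Σ_{p∈Pl} etaScale η (R p)`, read from `(fields, |·|_{(−1)})` to `(gradient fields, |·|_{(−3)})`, satisfies
`Prop4Hyp (…) (8·(a₀ + c·ε)·m·Lc⁴) (ε∕2)` — END-II's `hW` SHAPE for this part of ONE W-a binder, constants VOLUME-FREE
and k-UNIFORM; nothing printed is asserted. [folklore] -/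
theorem prop4Hyp_locGrad_etaScale_levels {η ε a₀ c Lc : ℝ} {m : ℕ} (hη : 0 < η) (hε : 0 < ε) (ha₀ : 0 ≤ a₀)
    (hc : 0 ≤ c) (hε4 : 4 * ε ≤ 1) (hLc1 : 1 ≤ Lc) (hηW : ∀ p ∈ Pl, η ≤ W p)
    (hWw : ∀ p ∈ Pl, ∀ b ∈ supp p, W p ≤ w b) (hwW : ∀ p ∈ Pl, ∀ b ∈ supp p, w b ≤ Lc * W p)
    (hloc : ∀ p ∈ Pl, ∀ A : Λ → 𝔸, ∀ b ∉ supp p, ∀ X : 𝔸, R p (A + Pi.single b X) = R p A)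
    (ha : ∀ p ∈ Pl, ∀ A, AnalyticAt ℂ (R p) A)
    (hR : ∀ p ∈ Pl, ∀ (A : Λ → 𝔸) (σ : ℝ), 0 ≤ σ → 4 * σ ≤ 1 → (∀ b ∈ supp p, ‖A b‖ ≤ σ) →
      ‖R p A‖ ≤ a p * σ ^ 3 + c * σ ^ 4)
    (haW : ∀ p ∈ Pl, a p ≤ a₀ * (η / W p) ^ 2)
    (hm : ∀ b : Λ, (Pl.filter (fun p => b ∈ supp p)).card ≤ m) :
    Prop4Hyp (fun Y : WSup w 1 𝔸 =>
        ((WSup.toPiL w 3).symm (locGrad (fun A => ∑ p ∈ Pl, etaScale η (R p) A) (WSup.toPiL w 1 Y)) :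
          WSup w 3 (𝔸 →L[ℂ] ℂ)))
      (8 * (a₀ + c * ε) * m * Lc ^ 4) (ε / 2) := by
  have hκ : 0 ≤ a₀ + c * ε := by positivity
  have hW : ∀ p ∈ Pl, 0 < W p := fun p hp => hη.trans_le (hηW p hp)
  exact prop4Hyp_locGrad_levels Pl (fun p => etaScale η (R p)) supp w W hε hκ hLc1 hW hWw hwW
    (fun p hp => analyticOnNhd_etaScale (ha p hp) η _)
    (fun p hp => hcub_etaScale hη (hηW p hp) ha₀ hc (haW p hp) hε4 (hR p hp))
    (fun p hp A b hb X => etaScale_add_single (hloc p hp) η A hb X) hm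

/-- **(98) FROM THE SOURCE SPACE `max{|·|_{(−1)}, |∇·|_{(−2)}}`** (row S65 f2c `prop4Hyp_locGrad_levels_max` FIRED): the
same statement from `WMax w w′ Dv` for ANY `∇`-datum `Dv` and weights `w′` — the summand which the holder's f5d adds, by
`Prop4Hyp.add`, to the `∇`-part `ShellMeasureCommutatorLevels.prop4Hyp_locGrad_cubT_levels`. [folklore] -/
theorem prop4Hyp_locGrad_etaScale_levels_max {Λ' : Type*} [Fintype Λ'] {𝔅 : Type*} [NormedAddCommGroup 𝔅]
    [NormedSpace ℂ 𝔅] (w' : Λ' → ℝ) [Fact (∀ b, 0 < w' b)] (Dv : (Λ → 𝔸) →L[ℂ] (Λ' → 𝔅))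
    {η ε a₀ c Lc : ℝ} {m : ℕ} (hη : 0 < η) (hε : 0 < ε) (ha₀ : 0 ≤ a₀)
    (hc : 0 ≤ c) (hε4 : 4 * ε ≤ 1) (hLc1 : 1 ≤ Lc) (hηW : ∀ p ∈ Pl, η ≤ W p)
    (hWw : ∀ p ∈ Pl, ∀ b ∈ supp p, W p ≤ w b) (hwW : ∀ p ∈ Pl, ∀ b ∈ supp p, w b ≤ Lc * W p)
    (hloc : ∀ p ∈ Pl, ∀ A : Λ → 𝔸, ∀ b ∉ supp p, ∀ X : 𝔸, R p (A + Pi.single b X) = R p A)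
    (ha : ∀ p ∈ Pl, ∀ A, AnalyticAt ℂ (R p) A)
    (hR : ∀ p ∈ Pl, ∀ (A : Λ → 𝔸) (σ : ℝ), 0 ≤ σ → 4 * σ ≤ 1 → (∀ b ∈ supp p, ‖A b‖ ≤ σ) →
      ‖R p A‖ ≤ a p * σ ^ 3 + c * σ ^ 4)
    (haW : ∀ p ∈ Pl, a p ≤ a₀ * (η / W p) ^ 2)
    (hm : ∀ b : Λ, (Pl.filter (fun p => b ∈ supp p)).card ≤ m) :
    Prop4Hyp (fun Y : WMax w w' Dv =>
        ((WSup.toPiL w 3).symm (locGrad (fun A => ∑ p ∈ Pl, etaScale η (R p) A)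
          (WSup.toPiL w 1 (WMax.toWSupL w w' Dv Y))) : WSup w 3 (𝔸 →L[ℂ] ℂ)))
      (8 * (a₀ + c * ε) * m * Lc ^ 4) (ε / 2) := by
  have hκ : 0 ≤ a₀ + c * ε := by positivity
  have hW : ∀ p ∈ Pl, 0 < W p := fun p hp => hη.trans_le (hηW p hp)
  exact prop4Hyp_locGrad_levels_max w w' Dv Pl (fun p => etaScale η (R p)) supp W hε hκ hLc1 hW hWw hwW
    (fun p hp => analyticOnNhd_etaScale (ha p hp) η _)
    (fun p hp => hcub_etaScale hη (hηW p hp) ha₀ hc (haW p hp) hε4 (hR p hp))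
    (fun p hp A b hb X => etaScale_add_single (hloc p hp) η A hb X) hm

end Ends

/-! ## §3 The Wilson instance: `R p := V0remSym τ U₀ (∂ p)` (row S65 f4's `∇`-free remainder, trace-free) -/

section Wilson

variable [CompleteSpace 𝔸] [Fintype Λ] [DecidableEq Λ] [NormOneClass 𝔸] {P : Type*} (Pl : Finset P)
  (bd : P → Fin 4 → Λ × Bool) (w : Λ → ℝ) (W : P → ℝ) (τ : 𝔸 →L[ℂ] ℂ) {U : Λ → 𝔸ˣ}
  (hU : ∀ b, ‖(U b : 𝔸)‖ ≤ 1) (hU' : ∀ b, ‖(((U b)⁻¹ : 𝔸ˣ) : 𝔸)‖ ≤ 1)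
include hU hU'

/-- THE RAW ONE-GRID BOUND OF S65 f4 IN §2's SHAPE: `‖V0remSym τ U₀ ∂p A‖ ≤ (‖τ‖·32∕3·‖U₀(∂p) − 1‖)·σ³ + (‖τ‖·40∕3)·σ⁴`
for `‖A b‖ ≤ σ` on `∂p`, `4σ ≤ 1` (`norm_V0remSym_le_of_bonds` with `ε₀ := ‖U₀(∂p) − 1‖`). [folklore] -/
theorem raw_V0remSym (q : Fin 4 → Λ × Bool) :
    ∀ (A : Λ → 𝔸) (σ : ℝ), 0 ≤ σ → 4 * σ ≤ 1 → (∀ b ∈ bonds q, ‖A b‖ ≤ σ) →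
      ‖V0remSym τ U q A‖ ≤ ‖τ‖ * (32 / 3) * ‖(plaqWord U q (0 : Λ → 𝔸) : 𝔸) - 1‖ * σ ^ 3 + ‖τ‖ * (40 / 3) * σ ^ 4 := by
  intro A σ _ hσ4 hA
  have h := norm_V0remSym_le_of_bonds hU hU' τ q (A := A) (ε₀ := ‖(plaqWord U q (0 : Λ → 𝔸) : 𝔸) - 1‖) le_rfl
    (fun i => hA _ (fst_mem_bonds q i)) hσ4
  linarith

/-- **(hcub) FOR THE ACTUAL PLAQUETTE REMAINDER, WEIGHT `W p`**: for `0 < η ≤ Wp`, `‖U₀(∂p) − 1‖ ≤ ε₀·(η∕Wp)²`, `0 ≤ ε₀`,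
`4ε ≤ 1`: `∀ A′ σ, 0 ≤ σ → σ < ε∕Wp → (∀ b′ ∈ ∂p, ‖A′ b′‖ ≤ σ) → ‖etaScale η (V0remSym τ U₀ ∂p) A′‖ ≤ (κ∕Wp)·σ³`,
**`κ = ‖τ‖·(32∕3·ε₀ + 40∕3·ε)`** — (40)'s SHAPE with `(ε₀, ε) ↔ (C₁B₃ε₁, ε₂)` (nothing printed asserted). [folklore] -/
theorem hcub_V0remSym_eta (q : Fin 4 → Λ × Bool) {η Wp ε₀ ε : ℝ} (hη : 0 < η) (hηW : η ≤ Wp) (hε₀ : 0 ≤ ε₀)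
    (hreg : ‖(plaqWord U q (0 : Λ → 𝔸) : 𝔸) - 1‖ ≤ ε₀ * (η / Wp) ^ 2) (hε4 : 4 * ε ≤ 1) :
    ∀ (A : Λ → 𝔸) (σ : ℝ), 0 ≤ σ → σ < ε / Wp → (∀ b' ∈ bonds q, ‖A b'‖ ≤ σ) →
      ‖etaScale η (V0remSym τ U q) A‖ ≤ ‖τ‖ * (32 / 3 * ε₀ + 40 / 3 * ε) / Wp * σ ^ 3 := by
  have h := hcub_etaScale (a := ‖τ‖ * (32 / 3) * ‖(plaqWord U q (0 : Λ → 𝔸) : 𝔸) - 1‖)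
    (a₀ := ‖τ‖ * (32 / 3) * ε₀) (c := ‖τ‖ * (40 / 3)) hη hηW (by positivity) (by positivity)
    (by nlinarith [norm_nonneg τ]) hε4 (raw_V0remSym τ hU hU' q)
  have e : (‖τ‖ * (32 / 3) * ε₀ + ‖τ‖ * (40 / 3) * ε) = ‖τ‖ * (32 / 3 * ε₀ + 40 / 3 * ε) := by ring
  rw [e] at h
  exact h

/-- **(97) BOND BY BOND FOR THE ACTUAL `∇`-FREE PLAQUETTE REMAINDER** (§2 at `R p := V0remSym τ U₀ (∂ p)`): unit-bounded
background with `‖U₀(∂p) − 1‖ ≤ ε₀·(η∕W p)²` for `p ∈ Pl`, weights `η ≤ W p ≤ w b ≤ Lc·W p` on `∂p`, incidence `≤ m`,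
`4ε ≤ 1`; for `w b·‖A′ b‖ ≤ s`, `2s < ε`: `(w b)³·‖locGrad (Σ_p etaScale η (V0remSym τ U₀ (∂ p))) A′ b‖ ≤ 8κ·m·Lc⁴·s²`,
`κ = ‖τ‖·(32∕3·ε₀ + 40∕3·ε)`, every bond, every `τ`. [folklore] -/
theorem weighted_locGrad_V0remSym_eta_le {η ε ε₀ Lc : ℝ} {m : ℕ} (hη : 0 < η) (hε₀ : 0 ≤ ε₀) (hε4 : 4 * ε ≤ 1)
    (hLc1 : 1 ≤ Lc) (hw : ∀ b, 0 < w b) (hηW : ∀ p ∈ Pl, η ≤ W p)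
    (hWw : ∀ p ∈ Pl, ∀ b ∈ bonds (bd p), W p ≤ w b) (hwW : ∀ p ∈ Pl, ∀ b ∈ bonds (bd p), w b ≤ Lc * W p)
    (hreg : ∀ p ∈ Pl, ‖(plaqWord U (bd p) (0 : Λ → 𝔸) : 𝔸) - 1‖ ≤ ε₀ * (η / W p) ^ 2)
    (hm : ∀ b : Λ, (Pl.filter (fun p => b ∈ bonds (bd p))).card ≤ m)
    {A : Λ → 𝔸} {s : ℝ} (hs : 0 ≤ s) (hA : ∀ b, w b * ‖A b‖ ≤ s) (h2s : 2 * s < ε) :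
    ∀ b : Λ, w b ^ 3 * ‖locGrad (fun A => ∑ p ∈ Pl, etaScale η (V0remSym τ U (bd p)) A) A b‖ ≤
      8 * (‖τ‖ * (32 / 3 * ε₀ + 40 / 3 * ε)) * m * Lc ^ 4 * s ^ 2 := by
  have e : ‖τ‖ * (32 / 3 * ε₀ + 40 / 3 * ε) = ‖τ‖ * (32 / 3) * ε₀ + ‖τ‖ * (40 / 3) * ε := by ring
  rw [e]
  exact weighted_locGrad_etaScale_le Pl (fun p => V0remSym τ U (bd p)) (fun p => bonds (bd p)) w W
    (fun p => ‖τ‖ * (32 / 3) * ‖(plaqWord U (bd p) (0 : Λ → 𝔸) : 𝔸) - 1‖) hη (by positivity) (by positivity) hε4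
    hLc1 hw hηW hWw hwW (fun p _ A b hb X => V0remSym_add_single hU hU' τ (bd p) A hb X)
    (fun p _ A => analyticAt_V0remSym hU hU' τ (bd p) A) (fun p _ => raw_V0remSym τ hU hU' (bd p))
    (fun p hp => by nlinarith [norm_nonneg τ, hreg p hp]) hm hs hA h2s

variable [hwf : Fact (∀ b, 0 < w b)]

/-- **(98) FOR THE ACTUAL `∇`-FREE PLAQUETTE REMAINDER AT THE LIVE LEVELS** (§2 at `R p := V0remSym τ U₀ (∂ p)`):
`Prop4Hyp (…) (8κ·m·Lc⁴) (ε∕2)` from `WSup w 1 𝔸` to `WSup w 3 (𝔸 →L[ℂ] ℂ)`, `κ = ‖τ‖·(32∕3·ε₀ + 40∕3·ε)`; VOLUME-FREE,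
k-UNIFORM, every `τ`. [folklore] -/
theorem prop4Hyp_locGrad_V0remSym_eta_levels {η ε ε₀ Lc : ℝ} {m : ℕ} (hη : 0 < η) (hε : 0 < ε) (hε₀ : 0 ≤ ε₀)
    (hε4 : 4 * ε ≤ 1) (hLc1 : 1 ≤ Lc) (hηW : ∀ p ∈ Pl, η ≤ W p)
    (hWw : ∀ p ∈ Pl, ∀ b ∈ bonds (bd p), W p ≤ w b) (hwW : ∀ p ∈ Pl, ∀ b ∈ bonds (bd p), w b ≤ Lc * W p)
    (hreg : ∀ p ∈ Pl, ‖(plaqWord U (bd p) (0 : Λ → 𝔸) : 𝔸) - 1‖ ≤ ε₀ * (η / W p) ^ 2)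
    (hm : ∀ b : Λ, (Pl.filter (fun p => b ∈ bonds (bd p))).card ≤ m) :
    Prop4Hyp (fun Y : WSup w 1 𝔸 =>
        ((WSup.toPiL w 3).symm (locGrad (fun A => ∑ p ∈ Pl, etaScale η (V0remSym τ U (bd p)) A)
          (WSup.toPiL w 1 Y)) : WSup w 3 (𝔸 →L[ℂ] ℂ)))
      (8 * (‖τ‖ * (32 / 3 * ε₀ + 40 / 3 * ε)) * m * Lc ^ 4) (ε / 2) := by
  have e : ‖τ‖ * (32 / 3 * ε₀ + 40 / 3 * ε) = ‖τ‖ * (32 / 3) * ε₀ + ‖τ‖ * (40 / 3) * ε := by ring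
  rw [e]
  exact prop4Hyp_locGrad_etaScale_levels Pl (fun p => V0remSym τ U (bd p)) (fun p => bonds (bd p)) w W
    (fun p => ‖τ‖ * (32 / 3) * ‖(plaqWord U (bd p) (0 : Λ → 𝔸) : 𝔸) - 1‖) hη hε (by positivity) (by positivity) hε4
    hLc1 hηW hWw hwW (fun p _ A b hb X => V0remSym_add_single hU hU' τ (bd p) A hb X)
    (fun p _ A => analyticAt_V0remSym hU hU' τ (bd p) A) (fun p _ => raw_V0remSym τ hU hU' (bd p))
    (fun p hp => by nlinarith [norm_nonneg τ, hreg p hp]) hm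

/-- **(98) FROM `max{|·|_{(−1)}, |∇·|_{(−2)}}` FOR THE ACTUAL `∇`-FREE PLAQUETTE REMAINDER** (§2 at
`R p := V0remSym τ U₀ (∂ p)`, f2c's source space, ANY `∇`-datum). [folklore] -/
theorem prop4Hyp_locGrad_V0remSym_eta_levels_max {Λ' : Type*} [Fintype Λ'] {𝔅 : Type*} [NormedAddCommGroup 𝔅]
    [NormedSpace ℂ 𝔅] (w' : Λ' → ℝ) [Fact (∀ b, 0 < w' b)] (Dv : (Λ → 𝔸) →L[ℂ] (Λ' → 𝔅))
    {η ε ε₀ Lc : ℝ} {m : ℕ} (hη : 0 < η) (hε : 0 < ε) (hε₀ : 0 ≤ ε₀)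
    (hε4 : 4 * ε ≤ 1) (hLc1 : 1 ≤ Lc) (hηW : ∀ p ∈ Pl, η ≤ W p)
    (hWw : ∀ p ∈ Pl, ∀ b ∈ bonds (bd p), W p ≤ w b) (hwW : ∀ p ∈ Pl, ∀ b ∈ bonds (bd p), w b ≤ Lc * W p)
    (hreg : ∀ p ∈ Pl, ‖(plaqWord U (bd p) (0 : Λ → 𝔸) : 𝔸) - 1‖ ≤ ε₀ * (η / W p) ^ 2)
    (hm : ∀ b : Λ, (Pl.filter (fun p => b ∈ bonds (bd p))).card ≤ m) :
    Prop4Hyp (fun Y : WMax w w' Dv =>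
        ((WSup.toPiL w 3).symm (locGrad (fun A => ∑ p ∈ Pl, etaScale η (V0remSym τ U (bd p)) A)
          (WSup.toPiL w 1 (WMax.toWSupL w w' Dv Y))) : WSup w 3 (𝔸 →L[ℂ] ℂ)))
      (8 * (‖τ‖ * (32 / 3 * ε₀ + 40 / 3 * ε)) * m * Lc ^ 4) (ε / 2) := by
  have e : ‖τ‖ * (32 / 3 * ε₀ + 40 / 3 * ε) = ‖τ‖ * (32 / 3) * ε₀ + ‖τ‖ * (40 / 3) * ε := by ring
  rw [e]
  exact prop4Hyp_locGrad_etaScale_levels_max Pl (fun p => V0remSym τ U (bd p)) (fun p => bonds (bd p)) w W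
    (fun p => ‖τ‖ * (32 / 3) * ‖(plaqWord U (bd p) (0 : Λ → 𝔸) : 𝔸) - 1‖) w' Dv hη hε (by positivity)
    (by positivity) hε4 hLc1 hηW hWw hwW (fun p _ A b hb X => V0remSym_add_single hU hU' τ (bd p) A hb X)
    (fun p _ A => analyticAt_V0remSym hU hU' τ (bd p) A) (fun p _ => raw_V0remSym τ hU hU' (bd p))
    (fun p hp => by nlinarith [norm_nonneg τ, hreg p hp]) hm

end Wilson

end Summit.QuantumFields.BalabanUV.T4Continuum.ShellMeasureWilsonRemainderLevels

end
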